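import Summits.KontsevichZagierPeriods.KontsevichZagierPeriods.Theorems.LinRedNormalFormArrangementNormalFormSeparateThreeHIPieces

/-!
# Fibres containing a fixed interval, and bounded pieces

(Line `janus-bands`, crux `ArrangementNormalForm`, stub `stub_separateThreeZero`, part `HIFixed` of
the termwise numerator split `separateThree_hI` under the rim condition.)

Two fibrewise estimates for the column lemma of `separateThree_hI` at base points whose closed
vertical fibre is NOT a rim point on the pole plane:
* `fixed_fibre` (registered as `separateThree_fixed`): on a vertical fibre `I` containing a fixed
  interval `[a₀, b₀]` and on which `|w| ≤ R`, and `w ≥ L > 0` unless `n = 0`, every weighted term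
  `|Qᵢ| w^i/w^n` of `∑_{j<N} Qⱼ w^j` is dominated in `L¹(I)` by `|∑ Qⱼ w^j| w^{-n}` (norm
  equivalence on `[a₀, b₀]`, `SepThree.exists_coeff_le_integral`);
* `FI_le_of_bounded`: if the `i`-th piece is bounded by `K` on the fibre and the fibre lies in
  `(-R, R)`, its fibre integral is at most `2RK`.
-/

noncomputable section

open Set MeasureTheory
open scoped ENNReal

namespace Summit.KontsevichZagierPeriods.ArrangementNormalForm.JanusBands

namespace SepThree

/-- **Fibres containing a fixed interval.** See the module docstring. -/
theorem fixed_fibre (N n : ℕ) {a₀ b₀ L R : ℝ} (hab : a₀ < b₀) (hL : 0 < L) (hLR : L ≤ R) :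
    ∃ C : ℝ≥0∞, C ≠ ∞ ∧ ∀ (Q : ℕ → ℝ) (I : Set ℝ), MeasurableSet I → Icc a₀ b₀ ⊆ I →
      (∀ w ∈ I, |w| ≤ R ∧ (n ≠ 0 → L ≤ w)) → ∀ i < N,
        ∫⁻ w in I, ‖Q i * (w ^ i / w ^ n)‖ₑ ≤ C * ∫⁻ w in I, ‖psum N Q w * (1 / w) ^ n‖ₑ := by
  obtain ⟨Cs, hCs, hco⟩ := exists_coeff_le_integral N hab
  have hR : 0 < R := hL.trans_le hLR
  set M := max 1 R with hM
  have hM1 : 1 ≤ M := le_max_left _ _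
  set Cr : ℝ := Cs * (M ^ N / L ^ n * (2 * R)) * R ^ n with hCr
  refine ⟨ENNReal.ofReal Cr, ENNReal.ofReal_ne_top, fun Q I hI hin hwI i hi => ?_⟩
  -- pointwise bound of the weighted term
  have hpt : ∀ w ∈ I, ‖Q i * (w ^ i / w ^ n)‖ₑ ≤ ENNReal.ofReal (|Q i| * (M ^ N / L ^ n)) := by
    intro w hw
    obtain ⟨hwR, hwL⟩ := hwI w hw
    rw [Real.enorm_eq_ofReal_abs, abs_mul, abs_div, abs_pow, abs_pow]
    refine ENNReal.ofReal_le_ofReal (mul_le_mul_of_nonneg_left ?_ (abs_nonneg _))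
    have hnum : |w| ^ i ≤ M ^ N :=
      (pow_le_pow_left₀ (abs_nonneg _) (hwR.trans (le_max_right _ _)) _).trans (pow_le_pow_right₀ hM1 hi.le)
    rcases Nat.eq_zero_or_pos n with hn | hn
    · simp only [hn, pow_zero, div_one]; exact hnum
    · have hwl : L ≤ |w| := (hwL hn.ne').trans (le_abs_self w)
      exact div_le_div₀ (by positivity) hnum (pow_pos hL _) (pow_le_pow_left₀ hL.le hwl _)
  have hvol : volume I ≤ ENNReal.ofReal (2 * R) := by
    calc volume I ≤ volume (Icc (-R) R) := measure_mono fun w hw => abs_le.1 (hwI w hw).1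
      _ = ENNReal.ofReal (2 * R) := by rw [Real.volume_Icc]; ring_nf
  -- the coefficient against the integral over `[a₀, b₀]`
  have hcoef := hco Q i hi
  have hint : IntegrableOn (fun w => |psum N Q w|) (Icc a₀ b₀) := (continuous_psum N Q).abs.integrableOn_Icc
  have hreal : ENNReal.ofReal (∫ w in a₀..b₀, |psum N Q w|) ≤
      ENNReal.ofReal (R ^ n) * ∫⁻ w in I, ‖psum N Q w * (1 / w) ^ n‖ₑ := by
    rw [intervalIntegral.integral_of_le hab.le, ← Measure.restrict_congr_set Ioc_ae_eq_Icc.symm,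
      ofReal_integral_eq_lintegral_ofReal hint (ae_of_all _ fun _ => abs_nonneg _)]
    calc ∫⁻ w in Icc a₀ b₀, ENNReal.ofReal |psum N Q w|
        ≤ ∫⁻ w in I, ENNReal.ofReal |psum N Q w| := lintegral_mono_set hin
      _ ≤ ∫⁻ w in I, ENNReal.ofReal (R ^ n) * ‖psum N Q w * (1 / w) ^ n‖ₑ := by
          refine setLIntegral_mono ((measurable_rhs N n Q).const_mul _) fun w hw => ?_
          obtain ⟨hwR, hwL⟩ := hwI w hw
          rw [Real.enorm_eq_ofReal_abs (psum N Q w * (1 / w) ^ n), ← ENNReal.ofReal_mul (by positivity)]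
          refine ENNReal.ofReal_le_ofReal ?_
          rw [abs_mul]
          have hge : 1 ≤ R ^ n * |(1 / w) ^ n| := by
            rcases Nat.eq_zero_or_pos n with hn | hn
            · simp [hn]
            · have hw0 : 0 < w := hL.trans_le (hwL hn.ne')
              rw [abs_of_pos (pow_pos (by positivity) _), ← mul_pow]
              refine one_le_pow₀ ?_
              rw [mul_one_div, le_div_iff₀ hw0, one_mul]
              exact (le_abs_self w).trans hwR
          calc |psum N Q w| = |psum N Q w| * 1 := (mul_one _).symm
            _ ≤ |psum N Q w| * (R ^ n * |(1 / w) ^ n|) := mul_le_mul_of_nonneg_left hge (abs_nonneg _)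
            _ = R ^ n * (|psum N Q w| * |(1 / w) ^ n|) := by ring
      _ = ENNReal.ofReal (R ^ n) * ∫⁻ w in I, ‖psum N Q w * (1 / w) ^ n‖ₑ :=
          lintegral_const_mul _ (measurable_rhs N n Q)
  -- assemble
  have hK0 : 0 ≤ M ^ N / L ^ n * (2 * R) := by positivity
  calc ∫⁻ w in I, ‖Q i * (w ^ i / w ^ n)‖ₑ
      ≤ ∫⁻ _ in I, ENNReal.ofReal (|Q i| * (M ^ N / L ^ n)) := setLIntegral_mono measurable_const hpt
    _ = ENNReal.ofReal (|Q i| * (M ^ N / L ^ n)) * volume I := setLIntegral_const _ _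
    _ ≤ ENNReal.ofReal (|Q i| * (M ^ N / L ^ n)) * ENNReal.ofReal (2 * R) := by gcongr
    _ = ENNReal.ofReal |Q i| * ENNReal.ofReal (M ^ N / L ^ n * (2 * R)) := by
        rw [← ENNReal.ofReal_mul (by positivity), ← ENNReal.ofReal_mul (abs_nonneg _)]; ring_nf
    _ ≤ ENNReal.ofReal (Cs * ∫ w in a₀..b₀, |psum N Q w|) * ENNReal.ofReal (M ^ N / L ^ n * (2 * R)) := by
        gcongr
    _ = ENNReal.ofReal (Cs * (M ^ N / L ^ n * (2 * R))) * ENNReal.ofReal (∫ w in a₀..b₀, |psum N Q w|) := by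
        rw [ENNReal.ofReal_mul hCs.le, ENNReal.ofReal_mul hCs.le]; ring
    _ ≤ ENNReal.ofReal (Cs * (M ^ N / L ^ n * (2 * R))) *
          (ENNReal.ofReal (R ^ n) * ∫⁻ w in I, ‖psum N Q w * (1 / w) ^ n‖ₑ) := by gcongr
    _ = ENNReal.ofReal Cr * ∫⁻ w in I, ‖psum N Q w * (1 / w) ^ n‖ₑ := by
        rw [← mul_assoc, ← ENNReal.ofReal_mul (mul_nonneg hCs.le hK0)]

/-- **Bounded pieces have bounded fibre integrals.** -/
theorem FI_le_of_bounded {m : ℕ} (κ : Fin m → Fin 2 → ℝ) (μ : Fin m → ℝ) (e : Fin m → ℕ)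
    (q : ℕ → MvPolynomial (Fin 2) ℝ) (n : ℕ) {Ω : Set ((Fin 2 → ℝ) × ℝ)} {R : ℝ}
    (hR : ∀ p ∈ Ω, |p.2| < R) (i : ℕ) (v : Fin 2 → ℝ) {K : ℝ}
    (hK : ∀ w ∈ fib Ω v, |tpiece κ μ e q n i (v, w)| ≤ K) :
    FI κ μ e q n Ω i v ≤ ENNReal.ofReal (2 * R * K) := by
  unfold FI
  rcases (fib Ω v).eq_empty_or_nonempty with hemp | ⟨w₀, hw₀⟩
  · rw [hemp]; simp
  · have hK0 : 0 ≤ K := (abs_nonneg _).trans (hK w₀ hw₀)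
    have hR0 : 0 ≤ R := (abs_nonneg _).trans (hR (v, w₀) hw₀).le
    calc ∫⁻ w in fib Ω v, ‖tpiece κ μ e q n i (v, w)‖ₑ ≤ ∫⁻ _ in fib Ω v, ENNReal.ofReal K := by
          refine setLIntegral_mono measurable_const fun w hw => ?_
          rw [Real.enorm_eq_ofReal_abs]
          exact ENNReal.ofReal_le_ofReal (hK w hw)
      _ = ENNReal.ofReal K * volume (fib Ω v) := setLIntegral_const _ _
      _ ≤ ENNReal.ofReal K * ENNReal.ofReal (2 * R) := by gcongr; exact volume_fib_le hR v
      _ = ENNReal.ofReal (2 * R * K) := by rw [← ENNReal.ofReal_mul hK0]; ring_nf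

end SepThree

/-- **Fibres containing a fixed interval** (registered part of `stub_separateThreeZero`; literal form
of `SepThree.fixed_fibre`): on a vertical fibre `I` containing `[a₀, b₀]`, with `|w| ≤ R` on `I` and
`w ≥ L > 0` on `I` unless `n = 0`, every weighted term `|Qᵢ| w^i/w^n` of a polynomial
`∑_{j<N} Qⱼ w^j` is dominated in `L¹(I)` by `|∑ Qⱼ w^j| w^{-n}`, with a constant depending only on
`N`, `n`, `a₀`, `b₀`, `L`, `R`. -/
theorem separateThree_fixed (N n : ℕ) (a₀ b₀ L R : ℝ) (hab : a₀ < b₀) (hL : 0 < L) (hLR : L ≤ R) : ∃ C : ENNReal, C ≠ ⊤ ∧ ∀ (Q : ℕ → ℝ) (I : Set ℝ), MeasurableSet I → Set.Icc a₀ b₀ ⊆ I → (∀ w ∈ I, |w| ≤ R ∧ (n ≠ 0 → L ≤ w)) → ∀ i < N, MeasureTheory.lintegral (MeasureTheory.volume.restrict I) (fun w => ‖Q i * (w ^ i / w ^ n)‖ₑ) ≤ C * MeasureTheory.lintegral (MeasureTheory.volume.restrict I) (fun w => ‖(∑ j ∈ Finset.range N, Q j * w ^ j) * (1 / w) ^ n‖ₑ)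 := by
  exact SepThree.fixed_fibre N n hab hL hLR

end Summit.KontsevichZagierPeriods.ArrangementNormalForm.JanusBands
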